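import Literature.MathematicalPhysics.QuantumFieldTheory.OSPointRealData
import HarnessLib

/-!
# Translation invariance of the local densities and of the real-point functions in the labels

Topic `Literature/MathematicalPhysics/QuantumFieldTheory`; support file (all proved; no new
definitions; no named facts) for the discharge of (A1) `OS1975_exists_timeContinuation`.
Osterwalder–Schrader II (Comm. Math. Phys. 42 (1975)), §IV.2 (4.4): by E1 the densities `S_N` of
Thm. 4.1 are translation invariant, `S_N(y + a) = S_N(y)` for every `a ∈ ℝᵈ` (uniqueness of
continuous local densities, as in `OSPointDensities.IsLocalDensity.add_timeVec`); consequently the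
real-point functions `pointS₀ k c Z` depend on the labels `c` only through their spatial parts and
are invariant under a common spatial translation of all labels — the translation invariance
`𝔚(z + a) = 𝔚(z)` of the continued functions at the real points.

## References

* K. Osterwalder, R. Schrader, *Axioms for Euclidean Green's functions II*, Comm. Math. Phys.
  42 (1975) 281–305, §IV.2 Thm. 4.1 (4.4), Thm. 4.3. [OsterwalderSchraderCMP1975]
-/

noncomputable section

open MeasureTheory Set Filter Metric
open _root_.Topology
open scoped SchwartzMap

namespace Literature.MathematicalPhysics.QuantumFieldTheory

variable {d : ℕ} [NeZero d]

open Literature.MathematicalPhysics.QuantumLattice (SchwingerFamily translateMulti translateMulti_apply)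
open Literature.MathematicalPhysics.QuantumLattice.SchwingerFamily
open Literature.MathematicalPhysics.QuantumFieldTheory.OSEnvelope

section LocalDensity

variable {N : ℕ} {𝔖 : SchwingerFamily (EuclideanSpace ℝ (Fin d))} {S : (Fin N → EuclideanSpace ℝ (Fin d)) → ℂ}

/-- Translation by a constant vector preserves increasing times. [folklore] -/
theorem add_const_mem_incrTimes {y : Fin N → EuclideanSpace ℝ (Fin d)} (hy : y ∈ incrTimes N d) (a : EuclideanSpace ℝ (Fin d)) :
    (fun j => y j + a) ∈ incrTimes N d := by
  rw [mem_incrTimes] at hy ⊢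
  intro i j hij
  have h := hy hij
  simp only [PiLp.add_apply] at h ⊢
  linarith

/-- **A continuous local density of a translation invariant distribution is translation invariant**:
`S (y + a) = S y` on the configurations with increasing times, for every `a ∈ ℝᵈ`. [cite: OsterwalderSchraderCMP1975, §IV.2 Thm. 4.1 (4.4)] -/
theorem IsLocalDensity.add_const (hS : IsLocalDensity 𝔖 N S) (hE1 : 𝔖.IsEuclideanCovariant) (a : EuclideanSpace ℝ (Fin d))
    {y : Fin N → EuclideanSpace ℝ (Fin d)} (hy : y ∈ incrTimes N d) :
    S (fun j => y j + a) = S y := by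
  set A : Fin N → EuclideanSpace ℝ (Fin d) := fun _ => a with hA
  have hyA : ∀ z : Fin N → EuclideanSpace ℝ (Fin d), (fun j => z j + a) = z + A := fun z => rfl
  set g : (Fin N → EuclideanSpace ℝ (Fin d)) → ℂ := fun z => S (z + A) with hg
  have hmaps : MapsTo (fun z : Fin N → EuclideanSpace ℝ (Fin d) => z + A) (incrTimes N d) (incrTimes N d) :=
    fun z hz => by show z + A ∈ incrTimes N d; rw [← hyA]; exact add_const_mem_incrTimes hz a
  have hgc : ContinuousOn g (incrTimes N d) := hS.cont.comp (continuous_id.add continuous_const).continuousOn hmaps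
  obtain ⟨ρ₁, hρ₁, hb₁, hrep₁⟩ := hS.rep y hy
  obtain ⟨ρ₂, hρ₂, hb₂, hrep₂⟩ := hS.rep (y + A) (hmaps hy)
  set V : Set (Fin N → EuclideanSpace ℝ (Fin d)) := ball y (min ρ₁ ρ₂) with hV
  have hVopen : IsOpen V := isOpen_ball
  have hyV : y ∈ V := mem_ball_self (lt_min hρ₁ hρ₂)
  have hV₁ : V ⊆ ball y ρ₁ := ball_subset_ball (min_le_left _ _)
  have hV₂ : V ⊆ ball y ρ₂ := ball_subset_ball (min_le_right _ _)
  have hVU : V ⊆ incrTimes N d := hV₁.trans hb₁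
  have heq := eqOn_of_forall_integral_mul_eq hVopen (hS.cont.mono hVU) (hgc.mono hVU) fun F hF _ => by
    rw [← hrep₁ F (hF.trans hV₁)]
    have hsupp : tsupport ((translateMulti a F : 𝓢((Fin N → EuclideanSpace ℝ (Fin d)), ℂ)) :
        (Fin N → EuclideanSpace ℝ (Fin d)) → ℂ) ⊆ ball (y + A) ρ₂ := by
      have h1 : ((translateMulti a F : 𝓢((Fin N → EuclideanSpace ℝ (Fin d)), ℂ)) :
          (Fin N → EuclideanSpace ℝ (Fin d)) → ℂ) = fun w => F (w - A) := by
        funext w; rw [translateMulti_apply]; rfl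
      rw [h1]
      refine (tsupport_comp_sub_subset F A).trans ?_
      rintro _ ⟨z, hz, rfl⟩
      have hz' : z ∈ ball y ρ₂ := hV₂ (hF hz)
      rw [mem_ball] at hz' ⊢
      simpa [dist_eq_norm] using hz'
    rw [← hE1.translateMulti N a F, hrep₂ _ hsupp]
    have h2 : (fun w => S w * (translateMulti a F : 𝓢((Fin N → EuclideanSpace ℝ (Fin d)), ℂ)) w) =
        fun w => (fun z => g z * F z) (w - A) := by
      funext w
      simp only [hg, translateMulti_apply, sub_add_cancel]
      rfl
    rw [h2]
    exact integral_sub_right_eq_self (fun z => g z * F z) A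
  have h := heq hyV
  rw [hg] at h
  simp only at h
  rw [hyA, h]

end LocalDensity

/-! ### Translation invariance of the real-point functions in the labels -/

section Labels

variable {𝔖 : SchwingerFamily (EuclideanSpace ℝ (Fin d))}
  (hE1 : 𝔖.IsEuclideanCovariant) (hE2 : 𝔖.IsOSReflectionPositive) (hE0 : 𝔖.HasLinearGrowth)

/-- Translating all labels translates the labelled configuration by the spatial part of the
translation. [folklore] -/
theorem labCfg_add_const {n : ℕ} (c : Fin (n + 1) → EuclideanSpace ℝ (Fin d)) (a : EuclideanSpace ℝ (Fin d)) (x : ℝ)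
    (ξ : Fin n → ℝ) : labCfg (fun j => c j + a) x ξ = fun j => labCfg c x ξ j + (a - timeVec (a 0)) := by
  funext j
  ext μ
  by_cases hμ : μ = 0
  · subst hμ
    simp [labCfg_apply_zero]
  · rw [labCfg_apply_of_ne_zero _ _ _ _ hμ]
    simp [labCfg_apply_of_ne_zero _ _ _ _ hμ, hμ]

/-- **The real-point functions are invariant under a common translation of the labels**:
`pointS₀ k (c + a) Z = pointS₀ k c Z`. [cite: OsterwalderSchraderCMP1975, §IV.2 (4.4), Thm. 4.3] -/
theorem pointS₀_add_const (k : ℕ) (c : Fin (k + 1) → EuclideanSpace ℝ (Fin d)) (a : EuclideanSpace ℝ (Fin d))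
    {Z : Fin k → ℂ} (hZ : ∀ i, 0 < (Z i).re) :
    pointS₀ hE1 hE2 hE0 k (fun j => c j + a) Z = pointS₀ hE1 hE2 hE0 k c Z := by
  cases k with
  | zero => rfl
  | succ k' =>
    simp only [pointS₀]
    rw [labCfg_add_const]
    exact (isLocalDensity_dens hE1 hE2 hE0 k').add_const hE1 _ (labCfg_mem_incrTimes c 0 hZ)

/-- The real-point functions depend on the labels only through their spatial parts. [folklore] -/
theorem pointS₀_add_timeVec_labels (k : ℕ) (c : Fin (k + 1) → EuclideanSpace ℝ (Fin d)) (t : Fin (k + 1) → ℝ)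
    (Z : Fin k → ℂ) :
    pointS₀ hE1 hE2 hE0 k (fun j => c j + timeVec (t j)) Z = pointS₀ hE1 hE2 hE0 k c Z := by
  cases k with
  | zero => rfl
  | succ k' =>
    simp only [pointS₀]
    rw [labCfg_add_timeVec_labels]

end Labels

end Literature.MathematicalPhysics.QuantumFieldTheory
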